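import Summits.Ventures.CertifiedQuantumChemistry.Rows.HubbardRingTVDihedralSymmetry
import Summits.Ventures.CertifiedQuantumChemistry.Rows.HubbardRingTVDoublonBound
import HarnessLib

/-!
# Ventures/CertifiedQuantumChemistry — Rows/HubbardRingTVEnergyFormula.lean: the RING ENERGY FORMULA on
# abstract pairs — for `L ≥ 3` the energy functional of the TV-H ring on ANY pair `(γ, Γ)` splits as
# `E(γ, Γ) = −t·Σ_p Σ_σ (γ_{pσ,(p+1)σ} + γ_{(p+1)σ,pσ}) + U·Σ_p Γ_{(p↑,p↓),(p↑,p↓)}`; at a rotation-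
# invariant pair this is `L` times a ONE-SITE expression, and `OPT_DQG/L = −2t·Σ_σ Re b_σ + U·d` at a
# symmetric optimum

HONEST FRAMING (verbatim): certified bounds for a stated model Hamiltonian in a stated basis; not a
claim about the real molecule beyond that model.

Seat rdm-B, ROWS courtesy file (theorems only; no `def`, no notation, no instance; zero compute). The
cell's strong-coupling programme for the half-filled rings (HOME/STRUCTURE.md §2, conjecture S-U and the
`X_∞` limit programmes) reads every relaxation value of `hubbardRingTV L t U` through two intensive
numbers — a nearest-neighbour BOND amplitude and a DOUBLON weight per site. Gen 38's
`Rows/HubbardRingTVDihedralSymmetry.lean` proved that a dihedral-invariant OPTIMAL pair exists and that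
its occupations / bonds / doublon weights are site-independent; what was missing is the elementary
identity that turns the energy functional into `L ×` (one-site expression). On the ring this needs the
neighbour sum `Σ_q [p ~ q] f q = f (p+1) + f (p−1)`, valid only for `L ≥ 3` (for `L = 2` the two
neighbours coincide; `L ≥ 3` is the intended range of `Hamiltonians/HubbardRingTV.lean`). This file:

* §1 (`RingSymmetry`) ring sums on `Fin L` written with the rotation `finRotate L` (`p ↦ p + 1`):
  `finRotate_ne_self` (`L ≥ 2`), `finRotate_finRotate_ne_self` (`L ≥ 3`), `ringAdj_iff_finRotate`
  (`p ~ q ↔ q = p+1 ∨ p = q+1`, `L ≥ 2`), **`sum_ite_ringAdj`** (`Σ_q [p ~ q] f q = f (p+1) + f (p−1)`,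
  `L ≥ 3`), **`sum_sum_ite_ringAdj`** (`Σ_p Σ_q [p ~ q] g p q = Σ_p (g p (p+1) + g (p+1) p)`, `L ≥ 3`).
* §2 (`RingEnergy`) the functional: `hubbardRingTV_h_cast` / `hubbardRingTV_eri_cast` (the tables cast to
  `ℂ`), `hubbardRingTV_oneBody_eq` (the one-body term on ANY 1-matrix), **`hubbardRingTV_rdmEnergy_eq`**
  (`E(γ, Γ) = −t·bonds + U·doublons` for any `γ` and any `Γ` antisymmetric in each index pair — the
  interaction term is the sibling's `StrongCouplingDoublon.interaction_eq`),
  **`hubbardRingTV_re_rdmEnergy_eq`** (real form for Hermitian `γ`: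
  `Re E = −2t Σ_p Σ_σ Re γ_{pσ,(p+1)σ} + U Σ_p Re d_p`), `…_of_feasible` (on any `(a, b)`-sector-feasible
  pair of the `D, Q, G` programme, whose rows supply Hermiticity and antisymmetry).
* §3 rotation-invariant pairs: **`hubbardRingTV_re_rdmEnergy_eq_mul_site`** — `Re E(γ, Γ) = L · (−2t Σ_σ
  Re γ_{p₀σ,(p₀+1)σ} + U Re Γ_{(p₀↑,p₀↓),(p₀↑,p₀↓)})` for EVERY site `p₀` (gen 38's `one_bond_eq`,
  `two_doublon_eq`); **`hubbardRingTV_exists_optimum_pqgSectorEnergy_eq_mul_site`** — for all `t, U`,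
  `a, b ≤ L`, `L ≥ 3` there is a dihedral-invariant OPTIMAL feasible pair at which
  `OPT_DQG(L; t, U; a, b) = L · (−2t Σ_σ Re b_σ + U d)` (`b_σ` its bond entry, `d` its doublon entry at
  any site): the relaxation value per site is a two-number expression.

The exact side (`⟨ψ, H ψ⟩ = −t·bonds + U·doublons`; `E₀/L = −4t·B + U·D` in the half-filled ground state)
is the sibling `Rows/HubbardRingTVGroundStateEnergyPerSite.lean`. READING: statements about the ABSTRACT
sector programme on the cell's own model object; no certificate, row, claim node or value of record
depends on this file. All PROVED (0 sorry, standard axioms); no defs, no named facts. References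
(docstring-only): D. A. Mazziotti, Adv. Chem. Phys. 134 (2007) ch. 3 §II.A–B (the energy functional
`Tr(¹K ¹D) + Tr(²K ²D)` — the tree's `rdmEnergy`); the rest is bookkeeping. Tree (REUSED):
`RingSymmetry.ringAdj_iff_add_one`, `one_bond_eq`, `two_doublon_eq`, `entrywise_of_submatrix`,
`hubbardRingTV_exists_dihedral_optimum` (gen 38), `StrongCouplingDoublon.interaction_eq` (gen 35);
Mathlib `finRotate_apply`, `Fintype.sum_eq_add`, `Equiv.sum_comp`.
-/

noncomputable section

namespace Summit.Ventures.CertifiedQuantumChemistry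

open Matrix Finset
open Literature.MathematicalPhysics.QuantumLattice Literature.MathematicalPhysics.QuantumChemistry
open Summit.Ventures.CertifiedQuantumChemistry.Hamiltonians
open scoped ComplexOrder

namespace RingSymmetry

/-! ## §1 Neighbour sums on the ring `Fin L`, `L ≥ 3` -/

section RingSums

variable {L : ℕ}

/-- On a ring with `L ≥ 2` sites the successor of a site is a different site: `p + 1 ≠ p`. [folklore] -/
theorem finRotate_ne_self (hL : 2 ≤ L) (p : Fin L) : finRotate L p ≠ p := by
  intro h
  have hv := congrArg Fin.val h
  haveI : NeZero L := ⟨by omega⟩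
  rw [finRotate_apply, Fin.val_add, Fin.val_one', Nat.mod_eq_of_lt (by omega : 1 < L)] at hv
  have p_lt := p.isLt
  by_cases hp : p.val + 1 < L
  · rw [Nat.mod_eq_of_lt hp] at hv
    omega
  · rw [Nat.mod_eq_sub_mod (by omega : L ≤ p.val + 1),
      Nat.mod_eq_of_lt (by omega : p.val + 1 - L < L)] at hv
    omega

/-- On a ring with `L ≥ 3` sites the second successor of a site is a different site: `p + 2 ≠ p`.
[folklore] -/
theorem finRotate_finRotate_ne_self (hL : 3 ≤ L) (p : Fin L) : finRotate L (finRotate L p) ≠ p := by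
  intro h
  have hv := congrArg Fin.val h
  haveI : NeZero L := ⟨by omega⟩
  rw [finRotate_apply, finRotate_apply, add_assoc, Fin.val_add, Fin.val_add, Fin.val_one',
    Nat.mod_eq_of_lt (by omega : 1 < L), Nat.add_mod_mod] at hv
  have p_lt := p.isLt
  by_cases hp : p.val + (1 + 1) < L
  · rw [Nat.mod_eq_of_lt hp] at hv
    omega
  · rw [Nat.mod_eq_sub_mod (by omega : L ≤ p.val + (1 + 1)),
      Nat.mod_eq_of_lt (by omega : p.val + (1 + 1) - L < L)] at hv
    omega

/-- **Adjacency on the ring, `L ≥ 2`**: `p ~ q` iff `q` is the successor of `p` or `p` is the successor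
of `q`. [folklore] -/
theorem ringAdj_iff_finRotate (hL : 2 ≤ L) (p q : Fin L) :
    Hamiltonians.ringAdj L p q ↔ q = finRotate L p ∨ p = finRotate L q := by
  haveI : NeZero L := ⟨by omega⟩
  rw [ringAdj_iff_add_one, finRotate_apply, finRotate_apply]
  constructor
  · rintro ⟨-, h | h⟩
    · exact Or.inl h.symm
    · exact Or.inr h.symm
  · rintro (h | h)
    · refine ⟨fun hpq => ?_, Or.inl h.symm⟩
      have h2 := finRotate_ne_self hL p
      rw [finRotate_apply] at h2
      exact h2 (h.symm.trans hpq.symm)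
    · refine ⟨fun hpq => ?_, Or.inr h.symm⟩
      have h2 := finRotate_ne_self hL q
      rw [finRotate_apply] at h2
      exact h2 (h.symm.trans hpq)

/-- **THE NEIGHBOUR SUM, `L ≥ 3`**: `Σ_q [p ~ q] f q = f (p + 1) + f (p − 1)` (the two neighbours are
distinct sites). [folklore] -/
theorem sum_ite_ringAdj (hL : 3 ≤ L) {M : Type*} [AddCommMonoid M] (f : Fin L → M) (p : Fin L) :
    (∑ q, if Hamiltonians.ringAdj L p q then f q else 0) = f (finRotate L p) + f ((finRotate L).symm p) := by
  have hne : finRotate L p ≠ (finRotate L).symm p := by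
    intro h
    have h2 := congrArg (finRotate L) h
    rw [Equiv.apply_symm_apply] at h2
    exact finRotate_finRotate_ne_self hL p h2
  rw [Fintype.sum_eq_add (finRotate L p) ((finRotate L).symm p) hne]
  · rw [if_pos ((ringAdj_iff_finRotate (by omega) _ _).2 (Or.inl rfl)),
      if_pos ((ringAdj_iff_finRotate (by omega) _ _).2 (Or.inr (Equiv.apply_symm_apply _ _).symm))]
  · rintro q ⟨hq1, hq2⟩
    rw [if_neg]
    rw [ringAdj_iff_finRotate (by omega)]
    rintro (h | h)
    · exact hq1 h
    · exact hq2 (by rw [h, Equiv.symm_apply_apply])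

/-- **THE DOUBLE NEIGHBOUR SUM, `L ≥ 3`**: `Σ_p Σ_q [p ~ q] g p q = Σ_p (g p (p+1) + g (p+1) p)` — every
bond is counted once in each orientation. [folklore] -/
theorem sum_sum_ite_ringAdj (hL : 3 ≤ L) {M : Type*} [AddCommMonoid M] (g : Fin L → Fin L → M) :
    (∑ p, ∑ q, if Hamiltonians.ringAdj L p q then g p q else 0) =
      ∑ p, (g p (finRotate L p) + g (finRotate L p) p) := by
  simp_rw [sum_ite_ringAdj hL]
  rw [Finset.sum_add_distrib, Finset.sum_add_distrib]
  congr 1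
  exact (Equiv.sum_comp (finRotate L).symm (fun q => g (finRotate L q) q)).symm.trans
    (Finset.sum_congr rfl fun p _ => by rw [Equiv.apply_symm_apply]) |>.symm

end RingSums

end RingSymmetry

/-! ## §2 The energy functional of the ring on an abstract pair: `E = −t·(bonds) + U·(doublons)` -/

namespace RingEnergy

open RingSymmetry

section Functional

variable {L : ℕ}

/-- The TV-H one-body table cast to `ℂ`: `h_pq = −t·[p ~ q]`. [folklore] -/
theorem hubbardRingTV_h_cast (t U : ℚ) (p q : Fin L) :
    ((hubbardRingTV L t U).h p q : ℂ) = if Hamiltonians.ringAdj L p q then -(t : ℂ) else 0 := by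
  simp only [hubbardRingTV]
  split_ifs <;> simp

/-- The TV-H two-body table cast to `ℂ`: `(pq|rs) = U·[p = q = r = s]`. [folklore] -/
theorem hubbardRingTV_eri_cast (t U : ℚ) (p q r s : Fin L) :
    ((hubbardRingTV L t U).eri p q r s : ℂ) = if p = q ∧ q = r ∧ r = s then (U : ℂ) else 0 := by
  simp only [hubbardRingTV]
  split_ifs <;> simp

/-- **THE ONE-BODY TERM OF THE RING ON ANY 1-MATRIX, `L ≥ 3`**:
`Σ_{pq} h_pq Σ_σ γ_{pσ,qσ} = −t Σ_p Σ_σ (γ_{pσ,(p+1)σ} + γ_{(p+1)σ,pσ})` — each bond once in each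
orientation. [folklore] -/
theorem hubbardRingTV_oneBody_eq (hL : 3 ≤ L) (t U : ℚ) (γ : Matrix (Orb (Fin L)) (Orb (Fin L)) ℂ) :
    ∑ p : Fin L, ∑ q : Fin L, ((hubbardRingTV L t U).h p q : ℂ) * ∑ σ : Fin 2, γ (orb p σ) (orb q σ) =
      -(t : ℂ) * ∑ p : Fin L, ∑ σ : Fin 2,
        (γ (orb p σ) (orb (finRotate L p) σ) + γ (orb (finRotate L p) σ) (orb p σ)) := by
  have h1 : ∀ p q : Fin L, ((hubbardRingTV L t U).h p q : ℂ) * ∑ σ : Fin 2, γ (orb p σ) (orb q σ) =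
      if Hamiltonians.ringAdj L p q then -(t : ℂ) * ∑ σ : Fin 2, γ (orb p σ) (orb q σ) else 0 := by
    intro p q
    rw [hubbardRingTV_h_cast]
    split_ifs <;> simp
  simp_rw [h1]
  rw [sum_sum_ite_ringAdj hL, Finset.mul_sum]
  refine Finset.sum_congr rfl fun p _ => ?_
  rw [← mul_add, ← Finset.sum_add_distrib]

/-- **THE RING ENERGY FORMULA ON AN ABSTRACT PAIR, `L ≥ 3`.** For every 1-matrix `γ` and every `Γ`
antisymmetric in each index pair, the energy functional of `hubbardRingTV L t U` is
`E(γ, Γ) = −t Σ_p Σ_σ (γ_{pσ,(p+1)σ} + γ_{(p+1)σ,pσ}) + U Σ_p Γ_{(p↑,p↓),(p↑,p↓)}`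
(`E_core = 0`; the interaction term is the sibling's `StrongCouplingDoublon.interaction_eq`). [folklore] -/
theorem hubbardRingTV_rdmEnergy_eq (hL : 3 ≤ L) (t U : ℚ) {γ : Matrix (Orb (Fin L)) (Orb (Fin L)) ℂ}
    {Γ : Matrix (Orb (Fin L) × Orb (Fin L)) (Orb (Fin L) × Orb (Fin L)) ℂ}
    (hfst : ∀ i j q, Γ (j, i) q = -Γ (i, j) q) (hsnd : ∀ p k l, Γ p (l, k) = -Γ p (k, l)) :
    rdmEnergy (fun p q => ((hubbardRingTV L t U).h p q : ℂ))
        (fun p q r s => ((hubbardRingTV L t U).eri p q r s : ℂ)) ((hubbardRingTV L t U).ecore : ℂ) γ Γ =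
      -(t : ℂ) * ∑ p : Fin L, ∑ σ : Fin 2,
          (γ (orb p σ) (orb (finRotate L p) σ) + γ (orb (finRotate L p) σ) (orb p σ)) +
        (U : ℂ) * ∑ p : Fin L, Γ (orb p 0, orb p 1) (orb p 0, orb p 1) := by
  have hcore : (((hubbardRingTV L t U).ecore : ℚ) : ℂ) = 0 := by simp [hubbardRingTV]
  rw [rdmEnergy, hubbardRingTV_oneBody_eq hL,
    StrongCouplingDoublon.interaction_eq hfst hsnd (U : ℂ) (hubbardRingTV_eri_cast t U), hcore, add_zero]

/-- For a Hermitian 1-matrix the two orientations of a bond are complex conjugate, so their sum has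
real part `2 Re γ_{pσ,(p+1)σ}`. [folklore] -/
theorem re_bond_add_bond_of_isHermitian {γ : Matrix (Orb (Fin L)) (Orb (Fin L)) ℂ} (hγ : γ.IsHermitian)
    (p : Fin L) (σ : Fin 2) :
    (γ (orb p σ) (orb (finRotate L p) σ) + γ (orb (finRotate L p) σ) (orb p σ)).re =
      2 * (γ (orb p σ) (orb (finRotate L p) σ)).re := by
  have h : γ (orb (finRotate L p) σ) (orb p σ) = star (γ (orb p σ) (orb (finRotate L p) σ)) := by
    conv_lhs => rw [← hγ]
    rfl
  rw [Complex.add_re, h, Complex.star_def, Complex.conj_re, two_mul]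

/-- **REAL FORM OF THE RING ENERGY FORMULA, `L ≥ 3`.** For a Hermitian `γ` and an antisymmetric `Γ`:
`Re E(γ, Γ) = −2t Σ_p Σ_σ Re γ_{pσ,(p+1)σ} + U Σ_p Re Γ_{(p↑,p↓),(p↑,p↓)}`. [folklore] -/
theorem hubbardRingTV_re_rdmEnergy_eq (hL : 3 ≤ L) (t U : ℚ) {γ : Matrix (Orb (Fin L)) (Orb (Fin L)) ℂ}
    {Γ : Matrix (Orb (Fin L) × Orb (Fin L)) (Orb (Fin L) × Orb (Fin L)) ℂ} (hγ : γ.IsHermitian)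
    (hfst : ∀ i j q, Γ (j, i) q = -Γ (i, j) q) (hsnd : ∀ p k l, Γ p (l, k) = -Γ p (k, l)) :
    (rdmEnergy (fun p q => ((hubbardRingTV L t U).h p q : ℂ))
        (fun p q r s => ((hubbardRingTV L t U).eri p q r s : ℂ)) ((hubbardRingTV L t U).ecore : ℂ) γ Γ).re =
      -2 * (t : ℝ) * ∑ p : Fin L, ∑ σ : Fin 2, (γ (orb p σ) (orb (finRotate L p) σ)).re +
        (U : ℝ) * ∑ p : Fin L, (Γ (orb p 0, orb p 1) (orb p 0, orb p 1)).re := by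
  rw [hubbardRingTV_rdmEnergy_eq hL t U hfst hsnd, Complex.add_re]
  have h1 : (-(t : ℂ) * ∑ p : Fin L, ∑ σ : Fin 2,
      (γ (orb p σ) (orb (finRotate L p) σ) + γ (orb (finRotate L p) σ) (orb p σ))).re =
      -2 * (t : ℝ) * ∑ p : Fin L, ∑ σ : Fin 2, (γ (orb p σ) (orb (finRotate L p) σ)).re := by
    rw [← Complex.ofReal_ratCast, ← Complex.ofReal_neg, Complex.re_ofReal_mul, Complex.re_sum]
    simp_rw [Complex.re_sum, re_bond_add_bond_of_isHermitian hγ, ← Finset.mul_sum]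
    ring
  have h2 : ((U : ℂ) * ∑ p : Fin L, Γ (orb p 0, orb p 1) (orb p 0, orb p 1)).re =
      (U : ℝ) * ∑ p : Fin L, (Γ (orb p 0, orb p 1) (orb p 0, orb p 1)).re := by
    rw [← Complex.ofReal_ratCast, Complex.re_ofReal_mul, Complex.re_sum]
  rw [h1, h2]

/-- **ON A FEASIBLE PAIR** of the `D, Q, G` programme with the sector rows (any `(a, b)`): the same
real form, the Hermiticity / antisymmetry hypotheses being rows of the programme. [folklore] -/
theorem hubbardRingTV_re_rdmEnergy_eq_of_feasible (hL : 3 ≤ L) (t U : ℚ) {a b : ℕ}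
    {γ : Matrix (Orb (Fin L)) (Orb (Fin L)) ℂ}
    {Γ : Matrix (Orb (Fin L) × Orb (Fin L)) (Orb (Fin L) × Orb (Fin L)) ℂ} (hf : IsDQGFeasibleSector a b γ Γ) :
    (rdmEnergy (fun p q => ((hubbardRingTV L t U).h p q : ℂ))
        (fun p q r s => ((hubbardRingTV L t U).eri p q r s : ℂ)) ((hubbardRingTV L t U).ecore : ℂ) γ Γ).re =
      -2 * (t : ℝ) * ∑ p : Fin L, ∑ σ : Fin 2, (γ (orb p σ) (orb (finRotate L p) σ)).re +
        (U : ℝ) * ∑ p : Fin L, (Γ (orb p 0, orb p 1) (orb p 0, orb p 1)).re :=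
  hubbardRingTV_re_rdmEnergy_eq hL t U hf.dqg.herm_one hf.dqg.swap_fst hf.dqg.swap_snd

end Functional

/-! ## §3 Rotation-invariant pairs: the energy is `L` times a one-site expression; `OPT/L` -/

section Invariant

variable {L : ℕ} {γ : Matrix (Orb (Fin L)) (Orb (Fin L)) ℂ}
  {Γ : Matrix (Orb (Fin L) × Orb (Fin L)) (Orb (Fin L) × Orb (Fin L)) ℂ}

/-- **THE INTENSIVE IDENTITY AT A ROTATION-INVARIANT PAIR, `L ≥ 3`.** If `γ` is Hermitian, `Γ`
antisymmetric and both are entrywise invariant under the rotation of the sites, then for EVERY site `p₀`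
`Re E(γ, Γ) = L · (−2t Σ_σ Re γ_{p₀σ,(p₀+1)σ} + U Re Γ_{(p₀↑,p₀↓),(p₀↑,p₀↓)})` — energy per site
`= −2t·(bond, both spins) + U·(doublon)`. [folklore] -/
theorem hubbardRingTV_re_rdmEnergy_eq_mul_site (hL : 3 ≤ L) (t U : ℚ) (hγh : γ.IsHermitian)
    (hfst : ∀ i j q, Γ (j, i) q = -Γ (i, j) q) (hsnd : ∀ p k l, Γ p (l, k) = -Γ p (k, l))
    (hγ : ∀ (p q : Fin L) (σ τ : Fin 2), γ (orb (finRotate L p) σ) (orb (finRotate L q) τ) = γ (orb p σ) (orb q τ))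
    (hΓ : ∀ (p q r s : Fin L) (σ τ υ φ : Fin 2),
      Γ (orb (finRotate L p) σ, orb (finRotate L q) τ) (orb (finRotate L r) υ, orb (finRotate L s) φ) =
        Γ (orb p σ, orb q τ) (orb r υ, orb s φ))
    (p₀ : Fin L) :
    (rdmEnergy (fun p q => ((hubbardRingTV L t U).h p q : ℂ))
        (fun p q r s => ((hubbardRingTV L t U).eri p q r s : ℂ)) ((hubbardRingTV L t U).ecore : ℂ) γ Γ).re =
      L * (-2 * (t : ℝ) * ∑ σ : Fin 2, (γ (orb p₀ σ) (orb (finRotate L p₀) σ)).re +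
        (U : ℝ) * (Γ (orb p₀ 0, orb p₀ 1) (orb p₀ 0, orb p₀ 1)).re) := by
  rw [hubbardRingTV_re_rdmEnergy_eq hL t U hγh hfst hsnd,
    Finset.sum_congr rfl fun p _ => Finset.sum_congr rfl fun σ _ =>
      congrArg Complex.re (one_bond_eq hγ p p₀ σ σ),
    Finset.sum_congr rfl fun p _ => congrArg Complex.re (two_doublon_eq hΓ p p₀)]
  simp only [Finset.sum_const, Finset.card_univ, Fintype.card_fin, nsmul_eq_mul]
  ring

/-- **`OPT/L` AT A SYMMETRIC OPTIMUM, `L ≥ 3`.** For every `t, U` and `a, b ≤ L` the `(a, b)` sector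
programme of `hubbardRingTV L t U` has an optimal feasible pair, invariant under every rotation and
reflection of the sites, at which for EVERY site `p₀`
`OPT_DQG(L; t, U; a, b) = L · (−2t Σ_σ Re γ_{p₀σ,(p₀+1)σ} + U Re Γ_{(p₀↑,p₀↓),(p₀↑,p₀↓)})`
(gen 38's `hubbardRingTV_exists_dihedral_optimum` read through §2). [folklore] -/
theorem hubbardRingTV_exists_optimum_pqgSectorEnergy_eq_mul_site (hL : 3 ≤ L) (t U : ℚ) {a b : ℕ}
    (ha : a ≤ L) (hb : b ≤ L) :
    ∃ γ Γ, IsDQGFeasibleSector a b γ Γ ∧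
      (∀ x ∈ Subgroup.closure ({finRotate L, Fin.revPerm} : Set (Equiv.Perm (Fin L))),
          γ.submatrix (Orb.mapEquiv x) (Orb.mapEquiv x) = γ ∧
            Γ.submatrix (Prod.map (Orb.mapEquiv x) (Orb.mapEquiv x))
              (Prod.map (Orb.mapEquiv x) (Orb.mapEquiv x)) = Γ) ∧
      ∀ p₀ : Fin L, Model.pqgSectorEnergy (hubbardRingTV L t U) a b =
        L * (-2 * (t : ℝ) * ∑ σ : Fin 2, (γ (orb p₀ σ) (orb (finRotate L p₀) σ)).re +
          (U : ℝ) * (Γ (orb p₀ 0, orb p₀ 1) (orb p₀ 0, orb p₀ 1)).re) := by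
  obtain ⟨γ, Γ, hf, hinv, hE⟩ := hubbardRingTV_exists_dihedral_optimum (L := L) t U ha hb
  have hr : finRotate L ∈ Subgroup.closure ({finRotate L, Fin.revPerm} : Set (Equiv.Perm (Fin L))) :=
    Subgroup.subset_closure (Set.mem_insert _ _)
  obtain ⟨hγ, hΓ⟩ := entrywise_of_submatrix (hinv _ hr).1 (hinv _ hr).2
  refine ⟨γ, Γ, hf, hinv, fun p₀ => ?_⟩
  rw [← hE]
  exact hubbardRingTV_re_rdmEnergy_eq_mul_site hL t U hf.dqg.herm_one hf.dqg.swap_fst hf.dqg.swap_snd hγ hΓ p₀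

end Invariant

end RingEnergy

end Summit.Ventures.CertifiedQuantumChemistry

end
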